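import Summits.HodgeConjecture.CorCM.MultiFieldWeilAnyTwoSimpleThreefoldsAnyCurves
import Summits.HodgeConjecture.CorCM.MultiFieldWeilAnyTwoSimpleDimLeThreeAnyCurve
import Summits.HodgeConjecture.CorCM.MultiFieldWeilSimpleThreefoldAnyCurves
import HarnessLib

/-!
# MULTI-FIELD WEIL ENGINE — A SIMPLE CM THREEFOLD, ANY SIMPLE CM PARTNER OF DIMENSION `≤ 3`, AND ANY FINITE FAMILY OF CM ELLIPTIC CURVES: the Hodge
# conjecture for every `T^a × A^b × ∏_c E_c^{n_c}`, given ONLY Markman's fourfold theorem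

Cell `pub-hodgecm2` (COR-CM), seat b30 gen 34 (2026-08-25); count-neutral own lane MULTI-FIELD WEIL ENGINE (stem `MultiFieldWeil*`), sequel of
`CorCM/MultiFieldWeilAnyTwoSimpleThreefoldsAnyCurves.lean` (two threefolds, any curves), `CorCM/MultiFieldWeilAnyTwoSimpleDimLeThreeAnyCurve.lean` (two simple of
dimension `≤ 3`, one curve) and gen 33's `CorCM/MultiFieldWeilSimpleThreefoldAnyCurves.lean` (one threefold, any curves).  Theorems only; no definition, no named fact, no
`sorry`.  HONEST FRAMING: conditional on the displayed Markman fourfold binder only; `HC_CM` is NOT proved and not asserted.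

THE STATEMENT (**`hodgeConjectureFor_prod_simpleThreefold_simple_dim_le_three_anyCurves_of_markman`**).  `T ⊨ (K; Φ)` a SIMPLE CM abelian threefold (sextic CM
field), `A ⊨ (K_A; Φ_A)` ANY simple CM abelian variety of dimension `≤ 3`, `E_c ⊨ (k_c; Ψ_c)` (`c ∈ I`, finite) ANY CM elliptic curves — isogenous or not, nothing assumed on
any field.  Then for every `π : Fin N → Fin 2 ⊕ I` the Hodge conjecture holds for `⨁_j Sum.elim ![T, A] E (π j)` — every `T^a × A^b × ∏_c E_c^{n_c}` — GIVEN ONLY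
`Markman2025_weilClasses_algebraic_abelianFourfold`; with the dominated form.

PROOF by the dimension of the partner.  `dim A = 3`: the previous roof (two threefolds, any curves).  `dim A = 1`: `A` is one more curve — gen 33's roof (ONE threefold, any
curves) on the curve family `Option I` (§1, a re-indexing).  `dim A = 2` (§2–§3): a simple CM SURFACE receives no imaginary quadratic field (b16), so after passing to
representatives of the isogeny classes of the curves, every curve except at most one `E_a` with `k_a ↪ K_T` is FOREIGN to `K_T`, `K_A` and `k_a` and the block of those
splits off (gen 33's `hodgeConjectureFor_prod_of_foreignCurves`); the rest `{T, A, E_a}` is the previous file's roof for two simple varieties of dimension `≤ 3` and one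
curve (curve absorption against a surface partner), or G7 when no curve goes to `K_T`.

[cite: MoonenZarhin1999LowDim, Thm. (0.1) (a), Thm. (0.2), §3 (3.1), Cor. (3.9), §5 (5.2)] [cite: Markman2025SurveySecant, Thm. 1.2] [cite: Gordon1999HodgeAVSurvey, §3 Theorem (proof), 7.4–7.7]
[cite: Shimura1998, §6.1 Corollary of Theorem 2 (p. 41), §8.4 (2), §18.1] [cite: MumfordAV1970, §19 Thm. 1 and p. 169]

## References
* [MoonenZarhin1999LowDim] B. Moonen, Yu. Zarhin, Math. Ann. 315 (1999) 711–733.  [Markman2025SurveySecant] E. Markman, arXiv:2509.23403, Thm. 1.2.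
  [Gordon1999HodgeAVSurvey] B. B. Gordon, *A survey of the Hodge conjecture for abelian varieties*, §3, 7.4–7.7.  [Shimura1998] G. Shimura, *Abelian varieties with
  complex multiplication and modular functions*, §6.1, §8.4, §18.1.  [MumfordAV1970] D. Mumford, *Abelian Varieties*, §19.
-/

noncomputable section

open CategoryTheory CategoryTheory.Limits NumberField IntermediateField

namespace Summit.HodgeConjecture.CorCM.MultiFieldWeil

open Literature.AlgebraicGeometry Literature.AlgebraicGeometry.Motives Literature.AlgebraicGeometry.HodgeTheory
open Literature.AlgebraicGeometry.ComplexMultiplication (IsCMTypeRealisation)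
open Literature.AlgebraicTopology.SingularHomology
open Literature.NumberTheory.ComplexMultiplication

open scoped Classical

section ThreefoldPartnerCurves

variable {I : Type} [Fintype I] {kq : I → Type} [fk : ∀ a, Field (kq a)] [nk : ∀ a, NumberField (kq a)] [ck : ∀ a, IsCMField (kq a)]
  {E : I → AbelianVariety ℂ} {Ψ : ∀ a, CMType (kq a)} {ιE : ∀ a, 𝓞 (kq a) →+* End (E a)} {θE : ∀ a, kq a →+* Module.End ℂ (complexBetti (E a).X 1)}
  {K K' : Type} [fK : Field K] [nK : NumberField K] [cK : IsCMField K] [fK' : Field K'] [nK' : NumberField K'] [cK' : IsCMField K']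
  {T A : AbelianVariety ℂ} {Φ : CMType K} {Φ' : CMType K'} {ιT : 𝓞 K →+* End T} {θT : K →+* Module.End ℂ (complexBetti T.X 1)}
  {ιA : 𝓞 K' →+* End A} {θA : K' →+* Module.End ℂ (complexBetti A.X 1)}

/-! ## §1 The partner is a curve: one threefold and one more curve (gen 33's roof, re-indexed) -/

omit [Fintype I] nk ck nK cK nK' cK' in
/-- The slots `inl 0 ↦ T`, `inl 1 ↦ A`, `inr c ↦ E_c` read on gen 33's Option family over the curve family `Option I` (`none ↦ A`, `some c ↦ E_c`) (bookkeeping).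
[folklore] -/
theorem sum_elim_eq_option_elim (s : Fin 2 ⊕ I) :
    (Sum.elim ![T, A] E s : AbelianVariety ℂ) =
      ((Sum.elim (![none, some none] : Fin 2 → Option (Option I)) (fun c => some (some c)) s).elim T (fun o : Option I => o.elim A E) :
        AbelianVariety ℂ) := by
  rcases s with i | c
  · fin_cases i
    · rfl
    · rfl
  · rfl

/-- **A SIMPLE CM THREEFOLD, ONE MORE CM ELLIPTIC CURVE `A`, AND ANY CM ELLIPTIC CURVES** — given ONLY Markman's fourfold theorem: the Hodge conjecture for every
`⨁_j Sum.elim ![T, A] E (π j)` (gen 33's `hodgeConjectureFor_prod_simpleThreefold_anyCurves_of_markman` on the curve family `Option I`). [cite: MoonenZarhin1999LowDim, Thm. (0.2), Cor. (3.9)]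
[cite: Markman2025SurveySecant, Thm. 1.2] -/
theorem hodgeConjectureFor_prod_simpleThreefold_cmCurve_anyCurves_of_markman (hW4 : Markman2025_weilClasses_algebraic_abelianFourfold) (h6 : Module.finrank ℚ K = 6)
    (h2A : Module.finrank ℚ K' = 2) (hT : IsCMTypeRealisation Φ T ιT θT) (hA : IsCMTypeRealisation Φ' A ιA θA) (hS : T.IsSimple)
    (h2 : ∀ a, Module.finrank ℚ (kq a) = 2) (hE : ∀ a, IsCMTypeRealisation (Ψ a) (E a) (ιE a) (θE a)) {N : ℕ} (π : Fin N → Fin 2 ⊕ I) :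
    HodgeConjectureFor (⨁ fun j => (Sum.elim ![T, A] E (π j) : AbelianVariety ℂ)).dim (⨁ fun j => (Sum.elim ![T, A] E (π j) : AbelianVariety ℂ)).X := by
  -- the curve family over `Option I`: `none ↦ (K', A)`, `some c ↦ (k_c, E_c)` (all identifications below are definitional)
  let kq' : Option I → Type := fun o => o.elim K' kq
  letI instF : ∀ o, Field (kq' o) := fun o => @Option.rec I (fun o => Field (Option.elim o K' kq)) fK' (fun a => fk a) o
  letI instN : ∀ o, NumberField (kq' o) := fun o => @Option.rec I (fun o => NumberField (Option.elim o K' kq)) nK' (fun a => nk a) o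
  haveI instC : ∀ o, IsCMField (kq' o) := fun o => @Option.rec I (fun o => IsCMField (Option.elim o K' kq)) cK' (fun a => ck a) o
  let Ψ' : ∀ o, CMType (kq' o) := fun o => @Option.rec I (fun o => CMType (Option.elim o K' kq)) Φ' (fun a => Ψ a) o
  let ιE' : ∀ o, 𝓞 (kq' o) →+* End ((o.elim A E : AbelianVariety ℂ)) :=
    fun o => @Option.rec I (fun o => 𝓞 (Option.elim o K' kq) →+* End ((o.elim A E : AbelianVariety ℂ))) ιA (fun a => ιE a) o
  let θE' : ∀ o, kq' o →+* Module.End ℂ (complexBetti (o.elim A E : AbelianVariety ℂ).X 1) :=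
    fun o => @Option.rec I (fun o => Option.elim o K' kq →+* Module.End ℂ (complexBetti (o.elim A E : AbelianVariety ℂ).X 1)) θA (fun a => θE a) o
  have hE' : ∀ o, IsCMTypeRealisation (Ψ' o) ((o.elim A E : AbelianVariety ℂ)) (ιE' o) (θE' o) := by
    intro o
    cases o with
    | none => exact hA
    | some a => exact hE a
  have h2' : ∀ o, Module.finrank ℚ (kq' o) = 2 := by
    intro o
    cases o with
    | none => exact h2A
    | some a => exact h2 a
  have hfun : (fun j => (Sum.elim ![T, A] E (π j) : AbelianVariety ℂ)) = fun j =>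
      ((Sum.elim (![none, some none] : Fin 2 → Option (Option I)) (fun c => some (some c)) (π j)).elim T (fun o : Option I => o.elim A E) :
        AbelianVariety ℂ) := funext fun j => sum_elim_eq_option_elim (π j)
  rw [hfun]
  exact @hodgeConjectureFor_prod_simpleThreefold_anyCurves_of_markman (Option I) _ kq' instF instN instC (fun o => (o.elim A E : AbelianVariety ℂ)) Ψ' ιE' θE'
    K fK nK cK T Φ ιT θT hW4 h6 hT hS h2' hE' N _

/-! ## §2 The partner is a surface: the rest block `{T, A, E_a}` and the foreign curves -/

omit [Fintype I] nk ck nK cK nK' cK' in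
/-- The slots with every curve slot equal to ONE curve `a`, read on `![T, A, E_a]` (bookkeeping). [folklore] -/
theorem sum_elim_partner_eq_vec_three {a : I} (s : Fin 2 ⊕ I) (hs : ∀ c, s = Sum.inr c → c = a) :
    (Sum.elim ![T, A] E s : AbelianVariety ℂ) = (![T, A, E a] : Fin 3 → AbelianVariety ℂ) (Sum.elim Fin.castSucc (fun _ => 2) s) := by
  rcases s with i | c
  · fin_cases i
    · rfl
    · rfl
  · cases hs c rfl
    rfl

omit [Fintype I] nk ck nK cK nK' cK' in
/-- The slots with NO curve slot, read on `![T, A]` (bookkeeping). [folklore] -/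
theorem sum_elim_partner_eq_vec_two (s : Fin 2 ⊕ I) (hs : ∀ c, s ≠ Sum.inr c) :
    (Sum.elim ![T, A] E s : AbelianVariety ℂ) = (![T, A] : Fin 2 → AbelianVariety ℂ) (Sum.elim id (fun _ => 0) s) := by
  rcases s with i | c
  · rfl
  · exact absurd rfl (hs c)

/-- **THE REST BLOCK for a partner avoiding every curve field.**  `T` a simple CM threefold, `A` a simple CM abelian variety of dimension `≤ 3` into whose field NO `k_c` embeds,
`E_c` pairwise non-isogenous CM elliptic curves; a product of copies in which every curve slot `inr c` has `k_c ↪ K_T`.  Then the Hodge conjecture holds for it, given only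
Markman's fourfold theorem: all curve slots carry ONE curve `a` (at most one curve per sextic field), and `![T, A, E_a]` is the previous file's roof (or `![T, A]` is G7).
[cite: MoonenZarhin1999LowDim, Thm. (0.1) (a), Thm. (0.2)] [cite: Markman2025SurveySecant, Thm. 1.2] -/
theorem hodgeConjectureFor_prod_sum_partner_of_forall_ringHom_of_markman (hW4 : Markman2025_weilClasses_algebraic_abelianFourfold) (h6 : Module.finrank ℚ K = 6)
    (hT : IsCMTypeRealisation Φ T ιT θT) (hA : IsCMTypeRealisation Φ' A ιA θA) (hS : T.IsSimple) (hSA : A.IsSimple) (h3A : A.dim ≤ 3)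
    (h2 : ∀ a, Module.finrank ℚ (kq a) = 2) (hE : ∀ a, IsCMTypeRealisation (Ψ a) (E a) (ιE a) (θE a))
    (hni : ∀ a b, a ≠ b → ¬ AbelianVariety.IsIsogenous (E a) (E b)) (hAK : ∀ a, IsEmpty (kq a →+* K')) {M : ℕ} (ρ : Fin M → Fin 2 ⊕ I)
    (hρ : ∀ l c, ρ l = Sum.inr c → Nonempty (kq c →+* K)) :
    HodgeConjectureFor (⨁ fun l => (Sum.elim ![T, A] E (ρ l) : AbelianVariety ℂ)).dim (⨁ fun l => (Sum.elim ![T, A] E (ρ l) : AbelianVariety ℂ)).X := by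
  have h3T : T.dim ≤ 3 := by rw [AndreProductForm.dim_eq_of_isCMTypeRealisation hT, h6]
  by_cases hex : ∃ a, Nonempty (kq a →+* K)
  · obtain ⟨a, ⟨fa⟩⟩ := hex
    have hs : ∀ l c, ρ l = Sum.inr c → c = a := fun l c h => eq_of_ringHom_of_ringHom_of_sextic h6 h2 hE hni (hρ l c h).some fa
    have hfun : (fun l => (Sum.elim ![T, A] E (ρ l) : AbelianVariety ℂ)) =
        fun l => (![T, A, E a] : Fin 3 → AbelianVariety ℂ) (Sum.elim Fin.castSucc (fun _ => 2) (ρ l)) := funext fun l => sum_elim_partner_eq_vec_three (ρ l) (hs l)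
    rw [hfun]
    exact hodgeConjectureFor_biproduct_comp_vec_of_two_simple_dim_le_three_cmCurve_of_ringHom_of_isEmpty hW4 hT hA hS hSA h3T h3A (h2 a) (hE a) fa (hAK a) _
  · have hs : ∀ l c, ρ l ≠ Sum.inr c := fun l c h => hex ⟨c, hρ l c h⟩
    have hfun : (fun l => (Sum.elim ![T, A] E (ρ l) : AbelianVariety ℂ)) =
        fun l => (![T, A] : Fin 2 → AbelianVariety ℂ) (Sum.elim id (fun _ => 0) (ρ l)) := funext fun l => sum_elim_partner_eq_vec_two (ρ l) (hs l)
    rw [hfun]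
    exact hodgeConjectureFor_biproduct_comp_vec_of_any_two_simple_dim_le_three_of_markman hW4 hT hA hS hSA h3T h3A _

/-- **A SIMPLE CM THREEFOLD, A SIMPLE PARTNER AVOIDING EVERY CURVE FIELD, AND PAIRWISE NON-ISOGENOUS CM ELLIPTIC CURVES** — given ONLY Markman's fourfold theorem: the Hodge
conjecture for every `⨁_j Sum.elim ![T, A] E (π j)`.  The curves whose fields do not embed in `K_T` are FOREIGN to every other member (to `K_T`; to `K_A` by hypothesis; to the
other curve fields, pairwise non-isomorphic) and split off (gen 33's `hodgeConjectureFor_prod_of_foreignCurves`); the rest is `hodgeConjectureFor_prod_sum_partner_of_forall_ringHom_of_markman`.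
[cite: MoonenZarhin1999LowDim, Thm. (0.2), §3 (3.1), Cor. (3.9)] [cite: Markman2025SurveySecant, Thm. 1.2] [cite: Gordon1999HodgeAVSurvey, §3 Theorem (proof), 7.5–7.7] -/
theorem hodgeConjectureFor_prod_simpleThreefold_partner_cmCurves_of_markman (hW4 : Markman2025_weilClasses_algebraic_abelianFourfold) (h6 : Module.finrank ℚ K = 6)
    (hT : IsCMTypeRealisation Φ T ιT θT) (hA : IsCMTypeRealisation Φ' A ιA θA) (hS : T.IsSimple) (hSA : A.IsSimple) (h3A : A.dim ≤ 3)
    (h2 : ∀ a, Module.finrank ℚ (kq a) = 2) (hE : ∀ a, IsCMTypeRealisation (Ψ a) (E a) (ιE a) (θE a))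
    (hni : ∀ a b, a ≠ b → ¬ AbelianVariety.IsIsogenous (E a) (E b)) (hAK : ∀ a, IsEmpty (kq a →+* K')) {N : ℕ} (π : Fin N → Fin 2 ⊕ I) :
    HodgeConjectureFor (⨁ fun j => (Sum.elim ![T, A] E (π j) : AbelianVariety ℂ)).dim (⨁ fun j => (Sum.elim ![T, A] E (π j) : AbelianVariety ℂ)).X := by
  -- the fields of two distinct curves are not isomorphic
  have hkk : ∀ a b, a ≠ b → IsEmpty (kq a →+* kq b) := fun a b hab => ⟨fun f => by
    obtain ⟨e⟩ := exists_ringEquiv_of_ringHom_of_finrank_eq f ((h2 a).trans (h2 b).symm)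
    exact hni a b hab (isIsogenous_of_ringEquiv (h2 b) (hE b) (hE a) e).symm'⟩
  -- all curves distinguished: the rest block directly
  by_cases hfor : ∃ a, IsEmpty (kq a →+* K)
  swap
  · exact hodgeConjectureFor_prod_sum_partner_of_forall_ringHom_of_markman hW4 h6 hT hA hS hSA h3A h2 hE hni hAK π fun l c _ =>
      not_isEmpty_iff.1 fun h => hfor ⟨c, h⟩
  obtain ⟨a₀, ha₀⟩ := hfor
  haveI : Nonempty I := ⟨a₀⟩
  -- the family over `Fin 2 ⊕ I`: `inl 0 ↦ (K, T)`, `inl 1 ↦ (K', A)`, `inr c ↦ (k_c, E_c)` (all identifications below are definitional)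
  let Kv : Fin 2 → Type := Fin.cons K (Fin.cons K' finZeroElim)
  let fKv : ∀ i, Field (Kv i) := Fin.cons fK (Fin.cons fK' finZeroElim)
  let nKv : ∀ i, NumberField (Kv i) := Fin.cons nK (Fin.cons nK' finZeroElim)
  have cKv : ∀ i, IsCMField (Kv i) := Fin.cons cK (Fin.cons cK' finZeroElim)
  let Φv : ∀ i : Fin 2, CMType (Kv i) := Fin.cons Φ (Fin.cons Φ' finZeroElim)
  let ιv : ∀ i : Fin 2, 𝓞 (Kv i) →+* End ((![T, A] : Fin 2 → AbelianVariety ℂ) i) := Fin.cons ιT (Fin.cons ιA finZeroElim)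
  let θv : ∀ i : Fin 2, Kv i →+* Module.End ℂ (complexBetti ((![T, A] : Fin 2 → AbelianVariety ℂ) i).X 1) := Fin.cons θT (Fin.cons θA finZeroElim)
  have hAv : ∀ i, IsCMTypeRealisation (Φv i) ((![T, A] : Fin 2 → AbelianVariety ℂ) i) (ιv i) (θv i) := Fin.cons hT (Fin.cons hA finZeroElim)
  let Kf : Fin 2 ⊕ I → Type := Sum.elim Kv kq
  letI instF : ∀ s, Field (Kf s) := fun s => @Sum.rec (Fin 2) I (fun s => Field (Sum.elim Kv kq s)) (fun i => fKv i) (fun a => fk a) s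
  letI instN : ∀ s, NumberField (Kf s) := fun s => @Sum.rec (Fin 2) I (fun s => NumberField (Sum.elim Kv kq s)) (fun i => nKv i) (fun a => nk a) s
  haveI instC : ∀ s, IsCMField (Kf s) := fun s => @Sum.rec (Fin 2) I (fun s => IsCMField (Sum.elim Kv kq s)) (fun i => cKv i) (fun a => ck a) s
  let Φf : ∀ s, CMType (Kf s) := fun s => @Sum.rec (Fin 2) I (fun s => CMType (Sum.elim Kv kq s)) (fun i => Φv i) (fun a => Ψ a) s
  let ιf : ∀ s, 𝓞 (Kf s) →+* End (Sum.elim ![T, A] E s : AbelianVariety ℂ) :=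
    fun s => @Sum.rec (Fin 2) I (fun s => 𝓞 (Sum.elim Kv kq s) →+* End (Sum.elim ![T, A] E s : AbelianVariety ℂ)) (fun i => ιv i) (fun a => ιE a) s
  let θf : ∀ s, Kf s →+* Module.End ℂ (complexBetti (Sum.elim ![T, A] E s : AbelianVariety ℂ).X 1) :=
    fun s => @Sum.rec (Fin 2) I (fun s => Sum.elim Kv kq s →+* Module.End ℂ (complexBetti (Sum.elim ![T, A] E s : AbelianVariety ℂ).X 1)) (fun i => θv i)
      (fun a => θE a) s
  have hAf : ∀ s, IsCMTypeRealisation (Φf s) (Sum.elim ![T, A] E s : AbelianVariety ℂ) (ιf s) (θf s) := by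
    rintro (i | a)
    · exact hAv i
    · exact hE a
  -- the marked slots: curves whose fields do not embed in `K_T`
  refine @hodgeConjectureFor_prod_of_foreignCurves (Fin 2 ⊕ I) _ Kf instF instN instC Φf (fun s => (Sum.elim ![T, A] E s : AbelianVariety ℂ)) ιf θf hAf
    (fun s => ∃ a, s = Sum.inr a ∧ IsEmpty (kq a →+* K)) _ ?_ ?_ ⟨Sum.inr a₀, a₀, rfl, ha₀⟩
    ⟨Sum.inl 0, by rintro ⟨a, h, -⟩; exact Sum.inl_ne_inr h⟩ ?_ ?_ N π
  · rintro _ ⟨a, rfl, -⟩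
    exact h2 a
  · rintro _ t ⟨a, rfl, ha⟩ ht
    rcases t with i | b
    · fin_cases i
      · exact ha
      · exact hAK a
    · have hab : a ≠ b := by
        rintro rfl
        exact ht ⟨a, rfl, ha⟩
      exact hkk a b hab
  · -- products of copies of the foreign curves (b16, unconditional)
    intro M ρ hρ
    choose a ha using hρ
    have hfun : (fun l => (Sum.elim ![T, A] E (ρ l) : AbelianVariety ℂ)) = fun l => E (a l) := funext fun l => by rw [(ha l).1]; rfl
    rw [hfun]
    exact hodgeConjectureFor_prod_of_pairwise_not_isIsogenous h2 hE hni a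
  · -- the rest block
    intro M ρ hρ
    exact hodgeConjectureFor_prod_sum_partner_of_forall_ringHom_of_markman hW4 h6 hT hA hS hSA h3A h2 hE hni hAK ρ fun l c h =>
      not_isEmpty_iff.1 fun hc => hρ l ⟨c, h, hc⟩

/-! ## §3 Any curves: representatives of the isogeny classes -/

/-- **A SIMPLE CM THREEFOLD, A SIMPLE PARTNER AVOIDING EVERY CURVE FIELD, AND ANY CM ELLIPTIC CURVES** (isogenous or not) — given ONLY Markman's fourfold theorem (one
representative per isogeny class, §2, then the isogeny). [cite: MoonenZarhin1999LowDim, Thm. (0.2), Cor. (3.9)] [cite: Markman2025SurveySecant, Thm. 1.2] [cite: MumfordAV1970, §19 Thm. 1 and p. 169] -/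
theorem hodgeConjectureFor_prod_simpleThreefold_partner_anyCurves_of_markman (hW4 : Markman2025_weilClasses_algebraic_abelianFourfold) (h6 : Module.finrank ℚ K = 6)
    (hT : IsCMTypeRealisation Φ T ιT θT) (hA : IsCMTypeRealisation Φ' A ιA θA) (hS : T.IsSimple) (hSA : A.IsSimple) (h3A : A.dim ≤ 3)
    (h2 : ∀ a, Module.finrank ℚ (kq a) = 2) (hE : ∀ a, IsCMTypeRealisation (Ψ a) (E a) (ιE a) (θE a)) (hAK : ∀ a, IsEmpty (kq a →+* K')) {N : ℕ}
    (π : Fin N → Fin 2 ⊕ I) :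
    HodgeConjectureFor (⨁ fun j => (Sum.elim ![T, A] E (π j) : AbelianVariety ℂ)).dim (⨁ fun j => (Sum.elim ![T, A] E (π j) : AbelianVariety ℂ)).X := by
  -- an auxiliary linear order on `I`, and the least index of each isogeny class as its representative
  letI : LinearOrder I := LinearOrder.lift' (Fintype.equivFin I) (Fintype.equivFin I).injective
  let cl : I → Finset I := fun a => Finset.univ.filter fun b => AbelianVariety.IsIsogenous (E a) (E b)
  have hcl : ∀ a b, b ∈ cl a ↔ AbelianVariety.IsIsogenous (E a) (E b) := fun a b => by
    simp only [cl, Finset.mem_filter, Finset.mem_univ, true_and]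
  have hne : ∀ a, (cl a).Nonempty := fun a => ⟨a, (hcl a a).2 (AbelianVariety.IsIsogenous.refl (E a))⟩
  let r : I → I := fun a => (cl a).min' (hne a)
  have hr_iso : ∀ a, AbelianVariety.IsIsogenous (E a) (E (r a)) := fun a => (hcl a (r a)).1 (Finset.min'_mem _ (hne a))
  have hr_le : ∀ a b, AbelianVariety.IsIsogenous (E a) (E b) → r a ≤ r b := fun a b h =>
    Finset.min'_le (cl a) (r b) ((hcl a (r b)).2 (h.trans (hr_iso b)))
  have hr_eq : ∀ a b, AbelianVariety.IsIsogenous (E a) (E b) → r a = r b := fun a b h => le_antisymm (hr_le a b h) (hr_le b a h.symm')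
  have hr_idem : ∀ a, r (r a) = r a := fun a => (hr_eq a (r a) (hr_iso a)).symm
  let J : Type := {b : I // r b = b}
  have hniJ : ∀ j j' : J, j ≠ j' → ¬ AbelianVariety.IsIsogenous (E j.1) (E j'.1) := fun j j' hne' h =>
    hne' (Subtype.ext (by rw [← j.2, ← j'.2]; exact hr_eq _ _ h))
  let ρ : I → J := fun a => ⟨r a, hr_idem a⟩
  have hiso : AbelianVariety.IsIsogenous (⨁ fun l => (Sum.elim ![T, A] E (π l) : AbelianVariety ℂ))
      (⨁ fun l => (Sum.elim ![T, A] (fun j : J => E j.1) ((π l).map id ρ) : AbelianVariety ℂ)) := by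
    refine AbelianVariety.IsIsogenous.biproduct fun l => ?_
    show AbelianVariety.IsIsogenous (Sum.elim ![T, A] E (π l)) (Sum.elim ![T, A] (fun j : J => E j.1) ((π l).map id ρ))
    rcases π l with i | a
    · exact AbelianVariety.IsIsogenous.refl _
    · exact hr_iso a
  exact Domination.hodgeConjectureFor_of_avDominatedBy
    (hodgeConjectureFor_prod_simpleThreefold_partner_cmCurves_of_markman (kq := fun j : J => kq j.1) (E := fun j : J => E j.1) (Ψ := fun j : J => Ψ j.1)
      (ιE := fun j : J => ιE j.1) (θE := fun j : J => θE j.1) hW4 h6 hT hA hS hSA h3A (fun j => h2 j.1) (fun j => hE j.1) hniJ (fun j => hAK j.1)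
      fun l => (π l).map id ρ)
    (Domination.AVDominatedBy.of_isIsogenous hiso (Domination.AVDominatedBy.refl _))

/-! ## §4 A simple CM threefold, any simple partner of dimension `≤ 3`, any curves -/

/-- **MAIN THEOREM — A SIMPLE CM THREEFOLD, ANY SIMPLE CM ABELIAN VARIETY OF DIMENSION `≤ 3`, AND ANY FINITE FAMILY OF CM ELLIPTIC CURVES, given ONLY Markman's fourfold
theorem.**  `T ⊨ (K; Φ)` a SIMPLE CM threefold (`[K : ℚ] = 6`), `A ⊨ (K_A; Φ_A)` simple of CM type with `dim A ≤ 3`, `E_c ⊨ (k_c; Ψ_c)` (`c ∈ I`, finite) CM elliptic curves —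
isogenous or not, nothing on any field.  Then for every `π : Fin N → Fin 2 ⊕ I` the Hodge conjecture holds for `⨁_j Sum.elim ![T, A] E (π j)` — every
`T^a × A^b × ∏_c E_c^{n_c}` — GIVEN ONLY `Markman2025_weilClasses_algebraic_abelianFourfold`.  `dim A = 1`: §1; `dim A = 2`: a simple CM surface receives no imaginary quadratic
field, §3; `dim A = 3`: the two-threefold roof.  `HC_CM` is NOT asserted. [cite: MoonenZarhin1999LowDim, Thm. (0.1), Thm. (0.2), §3 (3.1), Cor. (3.9), §5 (5.2)]
[cite: Markman2025SurveySecant, Thm. 1.2] [cite: Shimura1998, §8.4 (2), §18.1] -/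
theorem hodgeConjectureFor_prod_simpleThreefold_simple_dim_le_three_anyCurves_of_markman (hW4 : Markman2025_weilClasses_algebraic_abelianFourfold)
    (h6 : Module.finrank ℚ K = 6) (hT : IsCMTypeRealisation Φ T ιT θT) (hA : IsCMTypeRealisation Φ' A ιA θA) (hS : T.IsSimple) (hSA : A.IsSimple) (h3A : A.dim ≤ 3)
    (h2 : ∀ a, Module.finrank ℚ (kq a) = 2) (hE : ∀ a, IsCMTypeRealisation (Ψ a) (E a) (ιE a) (θE a)) {N : ℕ} (π : Fin N → Fin 2 ⊕ I) :
    HodgeConjectureFor (⨁ fun j => (Sum.elim ![T, A] E (π j) : AbelianVariety ℂ)).dim (⨁ fun j => (Sum.elim ![T, A] E (π j) : AbelianVariety ℂ)).X := by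
  have hd : Module.finrank ℚ K' = 2 ∨ Module.finrank ℚ K' = 4 ∨ Module.finrank ℚ K' = 6 := by
    have h := Literature.AlgebraicGeometry.Pohlmann1968.finrank_eq_two_mul_dim_of_isCMTypeRealisation hA
    have hp : 0 < Module.finrank ℚ K' := Module.finrank_pos
    interval_cases hdA : A.dim <;> omega
  rcases hd with h2A | h4A | h6A
  · -- the partner is a curve
    exact hodgeConjectureFor_prod_simpleThreefold_cmCurve_anyCurves_of_markman hW4 h6 h2A hT hA hS h2 hE π
  · -- the partner is a simple surface: it receives no imaginary quadratic field
    exact hodgeConjectureFor_prod_simpleThreefold_partner_anyCurves_of_markman hW4 h6 hT hA hS hSA h3A h2 hE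
      (fun a => isEmpty_ringHom_of_isSimple_of_finrank_eq_four h4A (h2 a) hA hSA) π
  · -- the partner is a threefold: the two-threefold roof
    exact hodgeConjectureFor_prod_two_simpleThreefolds_anyCurves_of_markman hW4 h6 h6A hT hA hS hSA h2 hE π

/-- **Dominated form**: everything dominated by a product of copies of a simple CM threefold, a simple CM abelian variety of dimension `≤ 3` and any CM elliptic curves
(everything isogenous to such a product, every abelian subvariety or quotient of one), given only Markman's fourfold theorem. [cite: MoonenZarhin1999LowDim, Thm. (0.1), (0.2)]
[cite: Markman2025SurveySecant, Thm. 1.2] [cite: MumfordAV1970, §19 Thm. 1 and p. 169] -/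
theorem hodgeConjectureFor_of_avDominatedBy_prod_simpleThreefold_simple_dim_le_three_anyCurves_of_markman (hW4 : Markman2025_weilClasses_algebraic_abelianFourfold)
    (h6 : Module.finrank ℚ K = 6) (hT : IsCMTypeRealisation Φ T ιT θT) (hA : IsCMTypeRealisation Φ' A ιA θA) (hS : T.IsSimple) (hSA : A.IsSimple) (h3A : A.dim ≤ 3)
    (h2 : ∀ a, Module.finrank ℚ (kq a) = 2) (hE : ∀ a, IsCMTypeRealisation (Ψ a) (E a) (ιE a) (θE a)) {N : ℕ} (π : Fin N → Fin 2 ⊕ I) {X : AbelianVariety ℂ}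
    (hX : Domination.AVDominatedBy X (⨁ fun j => (Sum.elim ![T, A] E (π j) : AbelianVariety ℂ))) : HodgeConjectureFor X.dim X.X :=
  Domination.hodgeConjectureFor_of_avDominatedBy
    (hodgeConjectureFor_prod_simpleThreefold_simple_dim_le_three_anyCurves_of_markman hW4 h6 hT hA hS hSA h3A h2 hE π) hX

end ThreefoldPartnerCurves

end Summit.HodgeConjecture.CorCM.MultiFieldWeil

end
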